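import Mathlib.NumberTheory.NumberField.ClassNumber
import Mathlib.NumberTheory.LegendreSymbol.JacobiSymbol
import Mathlib.Tactic.NormNum.LegendreSymbol
import Literature.NumberTheory.QuadraticFields.RealQuadraticFundamentalUnitValues
import Literature.NumberTheory.QuadraticFields.ClassNumberOne
import Literature.NumberTheory.QuadraticFields.HeegnerCondition
import HarnessLib

/-!
# Class number one for a real quadratic field all of whose primes below the Minkowski bound are inert
# (`d_K = 53, 173, 293, 437`: the first rungs of the all-inert ladder)

Topic `NumberTheory/QuadraticFields`, namespace `Literature.NumberTheory.QuadraticFields.Quadratic`, continuing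
`RealQuadraticFundamentalUnitValues.lean` (kernel units `QuadIrr.fundUnit_53 / _173 / _293 / _437`, `h_K = 1` for
`d_K < 16`) and `RealQuadraticClassNumberOneSmall.lean` (`h_K = 1` for every real `d_K < 36`). Everything here is
PROVED (theorems only; no definition, no named fact, no instance). The field is an abstract number field `K` with
`[K : ℚ] = 2` and a given `d_K`; an integral basis `(1, ω)`, `ω² = m + tω`, `d_K = t² + 4m` comes from
`HeegnerCondition.lean`.

The method is Marcus, *Number Fields*, Ch. 5, Cor. 2 of Thm. 37 and the examples after it, in the tree's form
`isPrincipal_of_mem_primesOver_of_no_root` (`ClassNumberOne.lean`: if `X² + uX + v` has a root `θ ∈ 𝓞 K` and no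
root mod `p`, every prime of `𝓞 K` above `p` is `(p)`) fed into Mathlib's
`RingOfIntegers.isPrincipalIdealRing_of_isPrincipal_of_pow_le_of_mem_primesOver_of_mem_Icc`: a real quadratic field
has Minkowski bound `M_K = √d_K/2`, so **if `d_K < 4(y+1)²` and every prime `p ≤ y` is INERT, then `h_K = 1`**.
Inertness is stated in Kronecker values exactly as the landau-siegel bed's `Repair.Bed.AllInertUpTo y D` does
(`Zhang2022/RepairBedModuli.lean`): `d_K ≡ 5 (mod 8)` at `p = 2` and the Jacobi (= Legendre) symbol `(d_K/p) = −1`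
at odd `p`; both say that `X² − tX − m` (discriminant `d_K`) has no root mod `p`.

## Main statements

* `no_root_two_of_emod_eight`, `no_root_of_jacobiSym_eq_neg_one` — the two «no root mod `p`» lemmas;
* **`classNumber_eq_one_of_inert`**: `[K:ℚ] = 2`, `0 < d_K < 4(y+1)²`, `d_K ≡ 5 (mod 8)`, `(d_K/p) = −1` for every
  odd prime `p ≤ y` ⇒ `h_K = 1`;
* the values **`classNumber_eq_one_of_discr_eq_53 / _173 / _293 / _437`** (`M_K = 3.64, 6.58, 8.56, 10.45`; the
  primes `≤ 3, 5, 7, 7` are inert — these `d_K` are the rungs `D_5^+ = 53`, `D_7^+ = D_11^+ = 173`, `D_13^+ = 293`,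
  `D_17^+ = 437` of the least-all-inert ladder, Lehmer–Lehmer–Shanks), and the class number formula quantities
  `regulator_of_discr_eq_53 … _437` (`R_K = log ε_D` with the kernel units) and
  `classNumber_mul_regulator_of_discr_eq_53 … _437` (`h_K R_K = log ε_D`).

The values agree with the tables (Cohen, GTM 138, Appendix B.2: `h(53) = 1`; `h(173) = h(293) = h(437) = 1` by the
same Minkowski argument, `437 = 19·23`). First consumer: the landau-siegel rescue bed
(`Zhang2022/RepairBedClassNumberFormulaReal.lean` rev 3: `L(1, χ_D) = 2 log ε_D/√D` at the positive ladder rungs).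
Not here: the deeper rungs `9173, 24653, 74093, …` (there `M_K` exceeds the inert range) and `d_K = 1365`.

## References

* [Marcus1977] D. A. Marcus, *Number Fields*, Ch. 3 Thm. 25 (decomposition of primes in quadratic fields) and
  Ch. 5, Cor. 2 of Thm. 37 with the examples following it (class number computations).
* [Cohen1993] H. Cohen, *A Course in Computational Algebraic Number Theory*, GTM 138 (1993), §5.7, Appendix B.2.
* [LehmerLehmerShanks1970] D. H. Lehmer, E. Lehmer, D. Shanks, *Integer sequences having prescribed quadratic
  character*, Math. Comp. 24 (1970) 433–451, §1 (the least discriminants with all small primes inert).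
* [JacobsonWilliams2008] M. J. Jacobson, H. C. Williams, *Solving the Pell Equation* (2008), §3.3 Table 3.1 (units).
-/

noncomputable section

open Module NumberField NumberField.InfinitePlace Ideal
open scoped nonZeroDivisors

namespace Literature.NumberTheory.QuadraticFields.Quadratic

variable {K : Type*} [Field K] [NumberField K]

/-! ### «No root mod `p`» from the Kronecker value `−1` -/

/-- `p = 2` inert: if `t² + 4m ≡ 5 (mod 8)` then `t, m` are odd and `X² − tX − m ≡ X² + X + 1` has no root in `𝔽₂`.
[cite: Marcus1977, Ch. 3 Thm. 25] -/
theorem no_root_two_of_emod_eight {t m : ℤ} (h : (t ^ 2 + 4 * m) % 8 = 5) :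
    ∀ a : ZMod 2, a ^ 2 + ((-t : ℤ) : ZMod 2) * a + ((-m : ℤ) : ZMod 2) ≠ 0 := by
  -- `t` and `m` are odd
  have htm : t % 2 = 1 ∧ m % 2 = 1 := by
    rcases Int.emod_two_eq_zero_or_one t with ht | ht
    · exfalso
      obtain ⟨s, rfl⟩ : ∃ s, t = 2 * s := ⟨t / 2, by omega⟩
      have hs : (2 * s) ^ 2 + 4 * m = 4 * (s ^ 2 + m) := by ring
      rw [hs] at h
      omega
    · obtain ⟨s, rfl⟩ : ∃ s, t = 2 * s + 1 := ⟨t / 2, by omega⟩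
      obtain ⟨e, he⟩ := Int.even_mul_succ_self s
      have hs : (2 * s + 1) ^ 2 + 4 * m = 4 * (s * (s + 1)) + 1 + 4 * m := by ring
      rw [hs, he] at h
      omega
  have ht : ((-t : ℤ) : ZMod 2) = 1 := by
    rw [← ZMod.intCast_mod (-t) 2, show (-t) % (2 : ℕ) = 1 by omega]
    rfl
  have hm : ((-m : ℤ) : ZMod 2) = 1 := by
    rw [← ZMod.intCast_mod (-m) 2, show (-m) % (2 : ℕ) = 1 by omega]
    rfl
  rw [ht, hm]
  decide

/-- Odd `p` inert: if the Legendre symbol `(t² + 4m / p) = −1` then `X² − tX − m` has no root mod `p` (a root `a`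
would give `(2a − t)² ≡ t² + 4m`). [cite: Marcus1977, Ch. 3 Thm. 25] -/
theorem no_root_of_jacobiSym_eq_neg_one {t m : ℤ} {p : ℕ} (hp : p.Prime)
    (hj : jacobiSym (t ^ 2 + 4 * m) p = -1) :
    ∀ a : ZMod p, a ^ 2 + ((-t : ℤ) : ZMod p) * a + ((-m : ℤ) : ZMod p) ≠ 0 := by
  haveI : Fact p.Prime := ⟨hp⟩
  intro a ha
  rw [← jacobiSym.legendreSym.to_jacobiSym, legendreSym.eq_neg_one_iff] at hj
  refine hj ⟨2 * a - (t : ZMod p), ?_⟩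
  push_cast at ha ⊢
  linear_combination (-4 : ZMod p) * ha

/-! ### Minkowski: inert primes below `√d_K/2` -/

/-- **`h_K = 1` for a real quadratic field all of whose primes below the Minkowski bound are inert.** If
`[K : ℚ] = 2`, `0 < d_K < 4(y+1)²` (so `M_K = √d_K/2 < y + 1`), `d_K ≡ 5 (mod 8)` (`2` inert) and `(d_K/p) = −1`
for every odd prime `p ≤ y`, then `h_K = 1`: each prime `𝔭` with `N𝔭 ≤ M_K` lies over an inert `p ≤ y`, hence is
`(p)`. [cite: Marcus1977, Ch. 5, Cor. 2 of Thm. 37 and the examples after it] -/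
theorem classNumber_eq_one_of_inert (h2 : finrank ℚ K = 2) (hd : 0 < NumberField.discr K) {y : ℕ}
    (hy : NumberField.discr K < 4 * ((y : ℤ) + 1) ^ 2) (h8 : NumberField.discr K % 8 = 5)
    (hin : ∀ p : ℕ, p.Prime → p ≠ 2 → p ≤ y → jacobiSym (NumberField.discr K) p = -1) :
    NumberField.classNumber K = 1 := by
  obtain ⟨-, hc0⟩ := nrRealPlaces_eq_two_and_nrComplexPlaces_eq_zero h2 hd
  obtain ⟨b, hb⟩ := exists_basis_zero_eq_one (K := K) h2
  have hω := basis_one_mul_self_eq b hb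
  have hdisc := discr_eq_sq_add_four_mul b hb
  set t : ℤ := b.repr (b 1 * b 1) 1
  set m : ℤ := b.repr (b 1 * b 1) 0
  -- `ω` is a root of `X² − tX − m`
  have hrel : (b 1) ^ 2 + ((-t : ℤ) : 𝓞 K) * b 1 + ((-m : ℤ) : 𝓞 K) = 0 := by
    rw [sq]
    push_cast
    linear_combination hω
  -- the Minkowski bound
  have hfloor : ⌊(4 / Real.pi) ^ nrComplexPlaces K *
      ((finrank ℚ K).factorial / (finrank ℚ K : ℝ) ^ finrank ℚ K *
        Real.sqrt |(NumberField.discr K : ℝ)|)⌋₊ ≤ y := by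
    rw [hc0, h2, pow_zero, one_mul]
    have hd' : |(NumberField.discr K : ℝ)| < 4 * ((y : ℝ) + 1) ^ 2 := by
      rw [abs_of_pos (by exact_mod_cast hd)]
      exact_mod_cast hy
    have hsqrt : Real.sqrt |(NumberField.discr K : ℝ)| < 2 * ((y : ℝ) + 1) := by
      rw [Real.sqrt_lt' (by positivity)]
      nlinarith
    have hfac : ((2 : ℕ).factorial : ℝ) = 2 := by norm_num [Nat.factorial]
    rw [hfac]
    refine Nat.le_of_lt_succ ((Nat.floor_lt (by positivity)).mpr ?_)
    calc 2 / (2 : ℝ) ^ 2 * Real.sqrt |(NumberField.discr K : ℝ)| < 2 / (2 : ℝ) ^ 2 * (2 * ((y : ℝ) + 1)) := by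
          gcongr
      _ = (y.succ : ℝ) := by push_cast; ring
  rw [NumberField.classNumber_eq_one_iff]
  refine RingOfIntegers.isPrincipalIdealRing_of_isPrincipal_of_pow_le_of_mem_primesOver_of_mem_Icc
    fun p hp hprime P hP _ => ?_
  have hpy : p ≤ y := (Finset.mem_Icc.mp hp).2.trans hfloor
  refine isPrincipal_of_mem_primesOver_of_no_root h2 hrel hprime ?_ hP
  by_cases hp2 : p = 2
  · subst hp2
    exact no_root_two_of_emod_eight (by rw [← hdisc]; exact h8)
  · have hj := hin p hprime hp2 hpy
    rw [hdisc] at hj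
    exact no_root_of_jacobiSym_eq_neg_one hprime hj

/-! ### The rungs `53, 173, 293, 437` -/

/-- **`h(ℚ(√53)) = 1`**: `d_K = 53 ⇒ h_K = 1` (`M_K = √53/2 < 4`; `2, 3` inert). [cite: Cohen1993, Appendix B Table B.2] -/
theorem classNumber_eq_one_of_discr_eq_53 (h2 : finrank ℚ K = 2) (hd : NumberField.discr K = 53) :
    NumberField.classNumber K = 1 := by
  refine classNumber_eq_one_of_inert h2 (by rw [hd]; norm_num) (y := 3) (by rw [hd]; norm_num)
    (by rw [hd]; rfl) fun p hp hp2 hp3 => ?_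
  rw [hd]
  interval_cases p <;> first | exact absurd hp (by decide) | exact absurd rfl hp2 | norm_num

/-- **`h(ℚ(√173)) = 1`**: `d_K = 173 ⇒ h_K = 1` (`M_K = √173/2 < 7`; `2, 3, 5` inert).
[cite: LehmerLehmerShanks1970, §1] -/
theorem classNumber_eq_one_of_discr_eq_173 (h2 : finrank ℚ K = 2) (hd : NumberField.discr K = 173) :
    NumberField.classNumber K = 1 := by
  refine classNumber_eq_one_of_inert h2 (by rw [hd]; norm_num) (y := 6) (by rw [hd]; norm_num)
    (by rw [hd]; rfl) fun p hp hp2 hp6 => ?_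
  rw [hd]
  interval_cases p <;> first | exact absurd hp (by decide) | exact absurd rfl hp2 | norm_num

/-- **`h(ℚ(√293)) = 1`**: `d_K = 293 ⇒ h_K = 1` (`M_K = √293/2 < 9`; `2, 3, 5, 7` inert).
[cite: LehmerLehmerShanks1970, §1] -/
theorem classNumber_eq_one_of_discr_eq_293 (h2 : finrank ℚ K = 2) (hd : NumberField.discr K = 293) :
    NumberField.classNumber K = 1 := by
  refine classNumber_eq_one_of_inert h2 (by rw [hd]; norm_num) (y := 8) (by rw [hd]; norm_num)
    (by rw [hd]; rfl) fun p hp hp2 hp8 => ?_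
  rw [hd]
  interval_cases p <;> first | exact absurd hp (by decide) | exact absurd rfl hp2 | norm_num

/-- **`h(ℚ(√437)) = 1`** (`437 = 19·23`): `d_K = 437 ⇒ h_K = 1` (`M_K = √437/2 < 11`; `2, 3, 5, 7` inert).
[cite: LehmerLehmerShanks1970, §1] -/
theorem classNumber_eq_one_of_discr_eq_437 (h2 : finrank ℚ K = 2) (hd : NumberField.discr K = 437) :
    NumberField.classNumber K = 1 := by
  refine classNumber_eq_one_of_inert h2 (by rw [hd]; norm_num) (y := 10) (by rw [hd]; norm_num)
    (by rw [hd]; rfl) fun p hp hp2 hp10 => ?_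
  rw [hd]
  interval_cases p <;> first | exact absurd hp (by decide) | exact absurd rfl hp2 | norm_num

/-! ### Regulators and `h_K R_K` at the rungs -/

/-- `d_K = 53`: `R_K = log ((7 + √53)/2)`. [cite: JacobsonWilliams2008, §3.3 Table 3.1] -/
theorem regulator_of_discr_eq_53 (h2 : finrank ℚ K = 2) (hd : NumberField.discr K = 53) :
    Units.regulator K = Real.log ((7 + 1 * Real.sqrt 53) / 2) :=
  regulator_eq_log_of_discr_eq h2 (D := 53) (by exact_mod_cast hd) QuadIrr.fundUnit_53

/-- `d_K = 173`: `R_K = log ((13 + √173)/2)`. [cite: JacobsonWilliams2008, §3.3 Table 3.1] -/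
theorem regulator_of_discr_eq_173 (h2 : finrank ℚ K = 2) (hd : NumberField.discr K = 173) :
    Units.regulator K = Real.log ((13 + 1 * Real.sqrt 173) / 2) :=
  regulator_eq_log_of_discr_eq h2 (D := 173) (by exact_mod_cast hd) QuadIrr.fundUnit_173

/-- `d_K = 293`: `R_K = log ((17 + √293)/2)`. [cite: JacobsonWilliams2008, §3.3 Table 3.1] -/
theorem regulator_of_discr_eq_293 (h2 : finrank ℚ K = 2) (hd : NumberField.discr K = 293) :
    Units.regulator K = Real.log ((17 + 1 * Real.sqrt 293) / 2) :=
  regulator_eq_log_of_discr_eq h2 (D := 293) (by exact_mod_cast hd) QuadIrr.fundUnit_293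

/-- `d_K = 437`: `R_K = log ((21 + √437)/2)`. [cite: JacobsonWilliams2008, §3.3 Table 3.1] -/
theorem regulator_of_discr_eq_437 (h2 : finrank ℚ K = 2) (hd : NumberField.discr K = 437) :
    Units.regulator K = Real.log ((21 + 1 * Real.sqrt 437) / 2) :=
  regulator_eq_log_of_discr_eq h2 (D := 437) (by exact_mod_cast hd) QuadIrr.fundUnit_437

/-- `d_K = 53`: `h_K · R_K = log ((7 + √53)/2)`. [cite: Cohen1993, Appendix B Table B.2] -/
theorem classNumber_mul_regulator_of_discr_eq_53 (h2 : finrank ℚ K = 2) (hd : NumberField.discr K = 53) :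
    (NumberField.classNumber K : ℝ) * Units.regulator K = Real.log ((7 + 1 * Real.sqrt 53) / 2) := by
  rw [classNumber_eq_one_of_discr_eq_53 h2 hd, regulator_of_discr_eq_53 h2 hd, Nat.cast_one, one_mul]

/-- `d_K = 173`: `h_K · R_K = log ((13 + √173)/2)`. [cite: LehmerLehmerShanks1970, §1] -/
theorem classNumber_mul_regulator_of_discr_eq_173 (h2 : finrank ℚ K = 2) (hd : NumberField.discr K = 173) :
    (NumberField.classNumber K : ℝ) * Units.regulator K = Real.log ((13 + 1 * Real.sqrt 173) / 2) := by
  rw [classNumber_eq_one_of_discr_eq_173 h2 hd, regulator_of_discr_eq_173 h2 hd, Nat.cast_one, one_mul]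

/-- `d_K = 293`: `h_K · R_K = log ((17 + √293)/2)`. [cite: LehmerLehmerShanks1970, §1] -/
theorem classNumber_mul_regulator_of_discr_eq_293 (h2 : finrank ℚ K = 2) (hd : NumberField.discr K = 293) :
    (NumberField.classNumber K : ℝ) * Units.regulator K = Real.log ((17 + 1 * Real.sqrt 293) / 2) := by
  rw [classNumber_eq_one_of_discr_eq_293 h2 hd, regulator_of_discr_eq_293 h2 hd, Nat.cast_one, one_mul]

/-- `d_K = 437`: `h_K · R_K = log ((21 + √437)/2)`. [cite: LehmerLehmerShanks1970, §1] -/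
theorem classNumber_mul_regulator_of_discr_eq_437 (h2 : finrank ℚ K = 2) (hd : NumberField.discr K = 437) :
    (NumberField.classNumber K : ℝ) * Units.regulator K = Real.log ((21 + 1 * Real.sqrt 437) / 2) := by
  rw [classNumber_eq_one_of_discr_eq_437 h2 hd, regulator_of_discr_eq_437 h2 hd, Nat.cast_one, one_mul]

end Literature.NumberTheory.QuadraticFields.Quadratic

end
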